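import Literature.AlgebraicGeometry.Hu2025.Statements.S04ModelV.R103dReadingR3
import Literature.AlgebraicGeometry.Hu2025.Proofs.S04ModelV.RootParents
import HarnessLib

/-!
# Hu 2025 §4.2.2, the remark after Ex. 4.14 ‹chunk 4.13› «a ℘-binomial does not admit any non-zero root parent» in READING R3
# («no cancellation in the descendant `f̄`», row 103 file d `C23L47_R3`): KERNEL DISCHARGE under a «no double lift»
# hypothesis on the index data, plus `C22L173_R3` (file `Proofs/S04ModelV/RootParentsR3.lean`; typer of record res-type-042, row 103)

**HONEST FRAMING (D-0012/D-0089).** Theorems about OUR typed renderings (`R103dReadingR3`: `IsDescentStepR3` … `C23L47_R3`,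
the third reading of Def. 4.11 ‹4.10›, next to R1 = res-type-044's and R2 = the term-wise one). Companion of
`RootParents.lean` / `RootParentsPlatformSix.lean`, where the R1/R2 renderings of the same remark are refuted at the platform
`Gr^{3,6}`. Together the three files say which reading the sentence chunk p0023 l.47–48 / PDF p.50 L027 needs; none of them is
a verdict on [Hu2025] (arXiv:2507.21400v1), which stays «under review»; AI proof is weaker than expert review; nothing here is
progress on resolution of singularities.

What is proved (every commutative ring `k`; all index data; every `Φ`):
* §1 R3 refines R2 (and R1): `isDescentStepR2_of_R3`, `isParentOfR2_of_R3`; hence `C22L173_R3_holds` (from `C22L173_R2_holds`).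
* §2 Ex. 4.14 is an R3 step (`isDescentStepR3_zero_wpBinomial`, nontrivial `k`): the two descended monomials of the zero
  expression `x_{t′}·x_t − x_t·x_{t′}` are distinct — so a ℘-binomial is never an R3 root polynomial.
* §3 Coefficients of a cancellation-free descended sum (`coeff_sum_exprSummandBar_of_notMem`, `…_of_mem`): the coefficient of
  `Σ_i x̄_{t_i} c_i x^{a_i}` at the exponent of the `i`-th summand IS `c_i`. Hence (`eq_zero_of_isDescentStepR3_zero`) the
  only R3 parent of `0` is `0`, and (`eq_zero_of_isDescentStepR3_wpBinomial`) every R3 one-step parent of the ℘-binomial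
  `x̄_{t′}x_t − x̄_t x_{t′}` is `0`, PROVIDED («no double lift», hypothesis `hNL`) no block carries two terms `h₁, h₂` with
  `x̄_{h₁} ∣ x̄_{t′}` and `x̄_{h₂} ∣ x̄_t` other than `(h₁, h₂) = (t′, t)` — then every descended summand is `± x̄_{t′}x_t` or
  `∓ x̄_t x_{t′}`, every written summand is a multiple of `x_{t′}x_t`, and the coefficients sum to `0` (evaluate `f̄ = B` at `1`).
* §4 `C23L47_R3_of_noDoubleLift`: under `hNL` for every pair of distinct terms of a block in play, `C23L47_R3 rel mono Φ` holds
  (head induction along the R3 parent chain: the chain is `… → 0 → 0 → B` or `B` itself, and `B` is not R3-root by §2).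
  The platform instance (`hNL` at `Gr^{3,n}`: within a block the chart monomials are pairwise incomparable, and no foreign block
  divides two of them) is recorded for `n = 6` in a companion file.
-/

noncomputable section

namespace Literature.AlgebraicGeometry.Hu2025.Proofs.S04ModelV

open MvPolynomial Literature.AlgebraicGeometry.Hu2025.Statements.S04ModelV

universe u v w x

variable {k : Type u} [CommRing k] {σ : Type v} {T : Type w} {𝔗 : Type x}

/-! ## §1 Reading R3 refines reading R2 -/

/-- Every R3 step is an R2 step (forget the no-cancellation conditions).
[cite: Hu2025, §4.2.2 Def. 4.11 ‹chunk 4.10›, chunk p0022 l.153–173, p.49 (unrefereed preprint arXiv:2507.21400v1 under adjudication, D-0012/D-0089 — kernel support on OUR typed renderings of row 103; nothing of the source asserted)] -/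
theorem isDescentStepR2_of_R3 [DecidableEq 𝔗] (rel : T → 𝔗) (mono : T → (σ →₀ ℕ)) (Φ : Set 𝔗) {F : 𝔗}
    {f g : ModelRing σ T k} (h : IsDescentStepR3 (k := k) rel mono Φ F f g) :
    IsDescentStepR2 (k := k) rel mono Φ F f g := by
  obtain ⟨l, hl, -, -, hf, hg⟩ := h
  exact ⟨l, hl, hf, hg⟩

/-- `IsParentOfR3 Φ f g → IsParentOfR2 Φ f g`.
[cite: Hu2025, §4.2.2 Def. 4.11 ‹chunk 4.10›, chunk p0022 l.153–173, p.49 (unrefereed preprint arXiv:2507.21400v1 under adjudication, D-0012/D-0089 — kernel support on OUR typed renderings of row 103; nothing of the source asserted)] -/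
theorem isParentOfR2_of_R3 [DecidableEq 𝔗] (rel : T → 𝔗) (mono : T → (σ →₀ ℕ)) (Φ : Set 𝔗)
    {f g : ModelRing σ T k} (h : IsParentOfR3 (k := k) rel mono Φ f g) : IsParentOfR2 (k := k) rel mono Φ f g := by
  induction h with
  | refl => exact Relation.ReflTransGen.refl
  | tail _ hstep ih =>
    obtain ⟨F, hF⟩ := hstep
    exact ih.tail ⟨F, isDescentStepR2_of_R3 rel mono Φ hF⟩

/-- **Reading R3 of the claim p0022 l.173 «`f ∈ ker^{mh} φ_[k]` iff any of its descendant does» — DISCHARGED AS TYPED**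
(from `C22L173_R2_holds`, since R3 steps are R2 steps).
[cite: Hu2025, §4.2.2 claim chunk p0022 l.173, p.49 L033 (unrefereed preprint arXiv:2507.21400v1 under adjudication, D-0012/D-0089 — kernel support on OUR typed renderings of row 103; nothing of the source asserted)] -/
theorem C22L173_R3_holds : ∀ {k : Type u} [CommRing k] {σ : Type v} {T : Type w} {𝔗 : Type x} [DecidableEq 𝔗]
    [DecidableEq σ] [DecidableEq T] (rel : T → 𝔗) (mono : T → (σ →₀ ℕ)) (Φ : Set 𝔗), C22L173_R3 (k := k) rel mono Φ :=
  fun rel mono Φ f g h => C22L173_R2_holds rel mono Φ f g (isParentOfR2_of_R3 rel mono Φ h)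

/-! ## §2 Ex. 4.14 ‹chunk 4.13› is an R3 step: `0 →_F B_F`, so a ℘-binomial is not an R3 root polynomial -/

/-- **Ex. 4.14 for reading R3** (nontrivial `k`): the zero expression `x_{t′}·x_t − x_t·x_{t′}` over the block of `t ≠ t′`
(in play) descends WITHOUT CANCELLATION to the ℘-binomial `x̄_{t′} x_t − x̄_t x_{t′}`: its two descended monomials are distinct
and carry the coefficients `1`, `−1`.
[cite: Hu2025, §4.2.2 Ex. 4.14 ‹chunk Ex. 4.13› (4.10), chunk p0023 l.35–45, p.50 L022–L026 (unrefereed preprint arXiv:2507.21400v1 under adjudication, D-0012/D-0089 — kernel support on OUR typed renderings of row 103; nothing of the source asserted)] -/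
theorem isDescentStepR3_zero_wpBinomial [DecidableEq 𝔗] [DecidableEq σ] [DecidableEq T] [Nontrivial k] (rel : T → 𝔗)
    (mono : T → (σ →₀ ℕ)) (Φ : Set 𝔗) {t t' : T} (hrel : rel t = rel t') (hne : t ≠ t') (hΦ : rel t ∈ Φ) :
    IsDescentStepR3 (k := k) rel mono Φ (rel t) 0 (wpBinomial (k := k) (σ := σ) mono t t') := by
  have key : ∀ (a b : T) (c : k), rel a = rel t → rel b = rel t →
      rel a = rel t ∧ exprSummand (k := k) (σ := σ) (a, Finsupp.single (Sum.inr b) 1, c) ∈ RSub (k := k) rel Φ ∧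
      ∀ G : 𝔗, IsWeightedHomogeneous (blockWeight rel G)
        (exprSummand (k := k) (σ := σ) (a, Finsupp.single (Sum.inr b) 1, c)) (if rel t = G then 2 else 0) := by
    intro a b c ha hb
    refine ⟨ha, ?_, ?_⟩
    · rw [exprSummand_eq]
      apply monomial_mem_RSub
      intro d hd
      rw [Finsupp.mem_support_iff, Finsupp.add_apply] at hd
      by_cases h1 : d = a
      · rw [h1, ha]; exact hΦ
      by_cases h2 : d = b
      · rw [h2, hb]; exact hΦ
      exfalso
      apply hd
      rw [Finsupp.single_eq_of_ne (fun e => h1 (Sum.inr_injective e)),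
        Finsupp.single_eq_of_ne (fun e => h2 (Sum.inr_injective e))]
      rfl
    · intro G
      rw [exprSummand_eq]
      apply isWeightedHomogeneous_monomial
      dsimp only
      rw [map_add, weight_blockWeight_single, weight_blockWeight_single, ha, hb]
      split_ifs <;> rfl
  refine ⟨[(t', Finsupp.single (Sum.inr t) 1, 1), (t, Finsupp.single (Sum.inr t') 1, -1)], ?_, ?_, ?_, ?_, ?_⟩
  · refine ⟨fun G => if rel t = G then 2 else 0, ?_⟩
    intro p hp
    simp only [List.mem_cons, List.not_mem_nil, or_false] at hp
    rcases hp with rfl | rfl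
    · exact key t' t 1 hrel.symm rfl
    · exact key t t' (-1) rfl hrel.symm
  · intro p hp
    simp only [List.mem_cons, List.not_mem_nil, or_false] at hp
    rcases hp with rfl | rfl
    · exact one_ne_zero
    · exact neg_ne_zero.mpr one_ne_zero
  · simp only [List.map_cons, List.map_nil, List.nodup_cons, List.mem_singleton, List.not_mem_nil, not_false_eq_true,
      List.nodup_nil, and_true]
    intro h
    have h1 := congrArg (fun d => d (Sum.inr t : σ ⊕ T)) h
    simp only [Finsupp.add_apply, monoR_apply_inr, zero_add, Finsupp.single_eq_same] at h1
    rw [Finsupp.single_eq_of_ne (fun e => hne (Sum.inr_injective e))] at h1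
    exact one_ne_zero h1
  · symm
    simp only [List.map_cons, List.map_nil, List.sum_cons, List.sum_nil, add_zero, exprSummand_eq]
    rw [add_comm (Finsupp.single (Sum.inr t') 1) (Finsupp.single (Sum.inr t) 1), ← map_add, add_neg_cancel, map_zero]
  · simp only [List.map_cons, List.map_nil, List.sum_cons, List.sum_nil, add_zero, exprSummandBar_eq]
    rw [Statements.S04ModelV.wpBinomial_eq, sub_eq_add_neg, ← map_neg]

/-- **A ℘-binomial (of a block in play, nontrivial `k`) is not an R3 root polynomial**: `0 ≠ B` is an R3 parent of `B`.
[cite: Hu2025, §4.2.2 Ex. 4.14 ‹chunk Ex. 4.13› / remark p0023 l.47–48, p.50 L022–L027 (unrefereed preprint arXiv:2507.21400v1 under adjudication, D-0012/D-0089 — kernel support on OUR typed renderings of row 103; nothing of the source asserted)] -/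
theorem not_isRootPolynomialR3_wpBinomial [DecidableEq 𝔗] [DecidableEq σ] [DecidableEq T] [Nontrivial k] (rel : T → 𝔗)
    (mono : T → (σ →₀ ℕ)) (Φ : Set 𝔗) {t t' : T} (hrel : rel t = rel t') (hne : t ≠ t') (hΦ : rel t ∈ Φ) :
    ¬ IsRootPolynomialR3 (k := k) rel mono Φ (wpBinomial (k := k) (σ := σ) mono t t') := by
  rintro ⟨-, -, hroot⟩
  have h0 := hroot 0 (Relation.ReflTransGen.single ⟨rel t, isDescentStepR3_zero_wpBinomial rel mono Φ hrel hne hΦ⟩)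
  exact wpBinomial_ne_zero mono hne h0.symm

/-! ## §3 Coefficients of a cancellation-free descended sum; the R3 parents of `0` and of a ℘-binomial -/

/-- The coefficient of a descended sum at an exponent that is none of the descended exponents is `0`.
[cite: Hu2025, §4.2.2 Def. 4.11 ‹chunk 4.10›, chunk p0022 l.153–162, p.49 (unrefereed preprint arXiv:2507.21400v1 under adjudication, D-0012/D-0089 — kernel support on OUR typed renderings of row 103; nothing of the source asserted)] -/
theorem coeff_sum_exprSummandBar_of_notMem [DecidableEq σ] [DecidableEq T] (mono : T → (σ →₀ ℕ))
    (l : List (T × (σ ⊕ T →₀ ℕ) × k)) (E : σ ⊕ T →₀ ℕ) (hE : E ∉ l.map fun p => monoR mono p.1 + p.2.1) :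
    coeff E (l.map (exprSummandBar (k := k) (σ := σ) mono)).sum = 0 := by
  induction l with
  | nil => simp
  | cons q l ih =>
    simp only [List.map_cons, List.mem_cons, not_or] at hE
    rw [List.map_cons, List.sum_cons, coeff_add, ih hE.2, add_zero, exprSummandBar_eq, coeff_monomial, if_neg]
    exact fun h => hE.1 h.symm

/-- In a descended sum WITHOUT CANCELLATION (pairwise distinct descended exponents), the coefficient at the exponent of the
summand `p` is its coefficient `c_p`.
[cite: Hu2025, §4.2.2 Def. 4.11 ‹chunk 4.10›, chunk p0022 l.153–162, p.49 (unrefereed preprint arXiv:2507.21400v1 under adjudication, D-0012/D-0089 — kernel support on OUR typed renderings of row 103; nothing of the source asserted)] -/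
theorem coeff_sum_exprSummandBar_of_mem [DecidableEq σ] [DecidableEq T] (mono : T → (σ →₀ ℕ))
    (l : List (T × (σ ⊕ T →₀ ℕ) × k)) (hnd : (l.map fun p => monoR mono p.1 + p.2.1).Nodup)
    {p : T × (σ ⊕ T →₀ ℕ) × k} (hp : p ∈ l) :
    coeff (monoR mono p.1 + p.2.1) (l.map (exprSummandBar (k := k) (σ := σ) mono)).sum = p.2.2 := by
  induction l with
  | nil => simp at hp
  | cons q l ih =>
    rw [List.map_cons, List.nodup_cons] at hnd
    rw [List.map_cons, List.sum_cons, coeff_add, exprSummandBar_eq, coeff_monomial]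
    rcases List.mem_cons.mp hp with rfl | hp'
    · rw [if_pos rfl, coeff_sum_exprSummandBar_of_notMem mono l _ hnd.1, add_zero]
    · rw [if_neg, zero_add, ih hnd.2 hp']
      intro h
      exact hnd.1 (h ▸ List.mem_map.mpr ⟨p, hp', rfl⟩)

/-- **The only R3 parent of `0` is `0`**: a cancellation-free descended sum with non-zero coefficients that vanishes is empty.
[cite: Hu2025, §4.2.2 Def. 4.11 ‹chunk 4.10› / remark p0023 l.47–48, pp. 49–50 (unrefereed preprint arXiv:2507.21400v1 under adjudication, D-0012/D-0089 — kernel support on OUR typed renderings of row 103; nothing of the source asserted)] -/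
theorem eq_zero_of_isDescentStepR3_zero [DecidableEq 𝔗] [DecidableEq σ] [DecidableEq T] (rel : T → 𝔗)
    (mono : T → (σ →₀ ℕ)) (Φ : Set 𝔗) {F : 𝔗} {f : ModelRing σ T k}
    (h : IsDescentStepR3 (k := k) rel mono Φ F f 0) : f = 0 := by
  obtain ⟨l, -, hc, hnd, rfl, h0⟩ := h
  cases l with
  | nil => simp
  | cons q l =>
    exfalso
    apply hc q (by simp)
    rw [← coeff_sum_exprSummandBar_of_mem mono (q :: l) hnd (by simp), ← h0, coeff_zero]

/-- Divisibility extracted from an equality of descended exponents: `monoR h + a = monoR t′ + e_s` forces `x̄_h ∣ x̄_{t′}`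
(`mono h ≤ mono t′`).
[cite: Hu2025, §4.2.2 Def. 4.11 ‹chunk 4.10›, chunk p0022 l.153–162, p.49 (unrefereed preprint arXiv:2507.21400v1 under adjudication, D-0012/D-0089 — kernel support on OUR typed renderings of row 103; nothing of the source asserted)] -/
theorem mono_le_of_exp_eq [DecidableEq σ] [DecidableEq T] (mono : T → (σ →₀ ℕ)) {h t' s : T} {a : σ ⊕ T →₀ ℕ}
    (he : monoR mono h + a = monoR mono t' + Finsupp.single (Sum.inr s : σ ⊕ T) 1) : mono h ≤ mono t' := by
  intro x
  have hx := congrArg (fun d => d (Sum.inl x : σ ⊕ T)) he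
  simp only [Finsupp.add_apply, monoR, Finsupp.mapDomain_apply Sum.inl_injective] at hx
  rw [Finsupp.single_eq_of_ne Sum.inl_ne_inr, add_zero] at hx
  omega

/-- Evaluating a descended sum at `(1, …, 1)` returns the sum of its coefficients.
[cite: Hu2025, §4.2.2 Def. 4.11 ‹chunk 4.10›, chunk p0022 l.153–162, p.49 (unrefereed preprint arXiv:2507.21400v1 under adjudication, D-0012/D-0089 — kernel support on OUR typed renderings of row 103; nothing of the source asserted)] -/
theorem eval_one_sum_exprSummandBar (mono : T → (σ →₀ ℕ)) (l : List (T × (σ ⊕ T →₀ ℕ) × k)) :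
    eval (fun _ : σ ⊕ T => (1 : k)) (l.map (exprSummandBar (k := k) (σ := σ) mono)).sum = (l.map fun p => p.2.2).sum := by
  induction l with
  | nil => simp
  | cons q l ih =>
    rw [List.map_cons, List.sum_cons, map_add, ih, List.map_cons, List.sum_cons, exprSummandBar_eq, eval_monomial]
    simp [Finsupp.prod]

/-- **Every R3 one-step parent of the ℘-binomial `B = x̄_{t′} x_t − x̄_t x_{t′}` is `0`**, provided NO DOUBLE LIFT: no block
carries terms `h₁, h₂` with `x̄_{h₁} ∣ x̄_{t′}` and `x̄_{h₂} ∣ x̄_t` other than `h₁ = t′`, `h₂ = t`. (Each descended summand then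
is `c·x̄_{t′}x_t` or `c·x̄_t x_{t′}` — its exponent lies in the support of `B` because the sum has no cancellation —, so each
written summand is `c·x_{t′}x_t`; the coefficients sum to `B(1,…,1) = 0`.)
[cite: Hu2025, §4.2.2 Def. 4.11 ‹chunk 4.10› / remark p0023 l.47–48 «a ℘-binomial does not admit any non-zero root parent», pp. 49–50 (unrefereed preprint arXiv:2507.21400v1 under adjudication, D-0012/D-0089 — kernel support on OUR typed renderings of row 103; nothing of the source asserted)] -/
theorem eq_zero_of_isDescentStepR3_wpBinomial [DecidableEq 𝔗] [DecidableEq σ] [DecidableEq T] (rel : T → 𝔗)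
    (mono : T → (σ →₀ ℕ)) (Φ : Set 𝔗) {t t' : T} (hne : t ≠ t')
    (hNL : ∀ h₁ h₂ : T, rel h₁ = rel h₂ → mono h₁ ≤ mono t' → mono h₂ ≤ mono t → h₁ = t' ∧ h₂ = t)
    {H : 𝔗} {f : ModelRing σ T k} (h : IsDescentStepR3 (k := k) rel mono Φ H f (wpBinomial (k := k) (σ := σ) mono t t')) :
    f = 0 := by
  obtain ⟨l, ⟨D, hD⟩, hc, hnd, rfl, hb⟩ := h
  -- over the trivial ring everything is `0`
  rcases subsingleton_or_nontrivial k with hk | hk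
  · exact Subsingleton.elim _ _
  -- the two exponents of `B`
  have hE : ∀ p ∈ l, monoR mono p.1 + p.2.1 = monoR mono t' + Finsupp.single (Sum.inr t) 1 ∨
      monoR mono p.1 + p.2.1 = monoR mono t + Finsupp.single (Sum.inr t') 1 := by
    intro p hp
    have hcoeff := coeff_sum_exprSummandBar_of_mem mono l hnd hp
    rw [← hb] at hcoeff
    have hsupp : monoR mono p.1 + p.2.1 ∈ (wpBinomial (k := k) (σ := σ) mono t t').support := by
      rw [mem_support_iff, hcoeff]; exact hc p hp
    exact (mem_support_wpBinomial_iff mono hne _).mp hsupp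
  -- both exponents of `B` occur
  have hE12 : monoR mono t' + Finsupp.single (Sum.inr t : σ ⊕ T) 1 ≠ monoR mono t + Finsupp.single (Sum.inr t') 1 :=
    wpExp_ne mono hne
  have hocc1 : coeff (monoR mono t' + Finsupp.single (Sum.inr t) 1) (wpBinomial (k := k) (σ := σ) mono t t') = 1 := by
    rw [Statements.S04ModelV.wpBinomial_eq, coeff_sub, coeff_monomial, coeff_monomial, if_pos rfl,
      if_neg hE12.symm, sub_zero]
  have hocc2 : coeff (monoR mono t + Finsupp.single (Sum.inr t') 1) (wpBinomial (k := k) (σ := σ) mono t t') = -1 := by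
    rw [Statements.S04ModelV.wpBinomial_eq, coeff_sub, coeff_monomial, coeff_monomial, if_neg hE12, if_pos rfl,
      zero_sub]
  have hmem1 : monoR mono t' + Finsupp.single (Sum.inr t) 1 ∈ l.map fun p => monoR mono p.1 + p.2.1 := by
    by_contra hn
    have h0 := coeff_sum_exprSummandBar_of_notMem mono l _ hn
    rw [← hb, hocc1] at h0
    exact one_ne_zero h0
  have hmem2 : monoR mono t + Finsupp.single (Sum.inr t') 1 ∈ l.map fun p => monoR mono p.1 + p.2.1 := by
    by_contra hn
    have h0 := coeff_sum_exprSummandBar_of_notMem mono l _ hn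
    rw [← hb, hocc2, neg_eq_zero] at h0
    exact one_ne_zero h0
  obtain ⟨p₁, hp₁, hp₁E⟩ := List.mem_map.mp hmem1
  obtain ⟨p₂, hp₂, hp₂E⟩ := List.mem_map.mp hmem2
  -- every written summand is `c · x_{t′} x_t`
  have hshape : ∀ p ∈ l, exprSummand (k := k) (σ := σ) p =
      monomial (Finsupp.single (Sum.inr t') 1 + Finsupp.single (Sum.inr t) 1) p.2.2 := by
    intro p hp
    rw [exprSummand_eq]
    rcases hE p hp with h1 | h2
    · obtain ⟨hpt, -⟩ := hNL p.1 p₂.1 ((hD p hp).1.trans (hD p₂ hp₂).1.symm) (mono_le_of_exp_eq mono h1)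
        (mono_le_of_exp_eq mono hp₂E)
      rw [hpt] at h1 ⊢
      rw [add_left_cancel h1]
    · obtain ⟨-, hpt⟩ := hNL p₁.1 p.1 ((hD p₁ hp₁).1.trans (hD p hp).1.symm) (mono_le_of_exp_eq mono hp₁E)
        (mono_le_of_exp_eq mono h2)
      rw [hpt] at h2 ⊢
      rw [add_left_cancel h2, add_comm]
  -- the coefficients sum to `B(1,…,1) = 0`
  have hsumc : (l.map fun p => p.2.2).sum = 0 := by
    rw [← eval_one_sum_exprSummandBar mono l, ← hb, Statements.S04ModelV.wpBinomial_eq, map_sub, eval_monomial,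
      eval_monomial]
    simp [Finsupp.prod]
  calc (l.map (exprSummand (k := k) (σ := σ))).sum
      = (l.map fun p => monomial (Finsupp.single (Sum.inr t') 1 + Finsupp.single (Sum.inr t) 1) p.2.2).sum := by
        congr 1; exact List.map_congr_left hshape
    _ = monomial (Finsupp.single (Sum.inr t') 1 + Finsupp.single (Sum.inr t) 1) ((l.map fun p => p.2.2).sum) := by
        rw [map_list_sum, List.map_map]; rfl
    _ = 0 := by rw [hsumc, map_zero]

/-! ## §4 The remark in reading R3, under «no double lift» -/

/-- **Hu 2025, remark after Ex. 4.14 ‹chunk 4.13› «a ℘-binomial does not admit any non-zero root parent», READING R3 —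
DISCHARGED under NO DOUBLE LIFT**: if for every pair of distinct terms `t ≠ t′` of a block in play no block carries terms
`h₁, h₂` with `x̄_{h₁} ∣ x̄_{t′}`, `x̄_{h₂} ∣ x̄_t` other than `(t′, t)`, then `C23L47_R3 rel mono Φ`: every R3 parent of a
℘-binomial `B` is `B` or `0` (head induction, §3), and `B` itself is not R3-root (§2).
[cite: Hu2025, §4.2.2 remark after Ex. 4.14 ‹chunk Ex. 4.13›, chunk p0023 l.47–48, p.50 L027 (unrefereed preprint arXiv:2507.21400v1 under adjudication, D-0012/D-0089 — kernel support on OUR typed rendering `C23L47_R3` of row 103 file d; nothing of the source asserted)] -/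
theorem C23L47_R3_of_noDoubleLift [DecidableEq 𝔗] [DecidableEq σ] [DecidableEq T] (rel : T → 𝔗)
    (mono : T → (σ →₀ ℕ)) (Φ : Set 𝔗)
    (hNL : ∀ t t' : T, rel t = rel t' → t ≠ t' → rel t ∈ Φ →
      ∀ h₁ h₂ : T, rel h₁ = rel h₂ → mono h₁ ≤ mono t' → mono h₂ ≤ mono t → h₁ = t' ∧ h₂ = t) :
    C23L47_R3 (k := k) (σ := σ) rel mono Φ := by
  rintro b ⟨t, t', htt', hne, hΦ, rfl, hb0⟩ f ⟨hroot, hpar⟩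
  haveI : Nontrivial k := by
    by_contra hk
    rw [not_nontrivial_iff_subsingleton] at hk
    exact hb0 (Subsingleton.elim _ _)
  -- along the chain every parent is `B` or `0`
  have hchain : ∀ g : ModelRing σ T k, IsParentOfR3 (k := k) rel mono Φ g (wpBinomial (k := k) (σ := σ) mono t t') →
      g = wpBinomial (k := k) (σ := σ) mono t t' ∨ g = 0 := by
    intro g hg
    induction hg using Relation.ReflTransGen.head_induction_on with
    | refl => exact Or.inl rfl
    | head hstep _ ih =>
      obtain ⟨H, hH⟩ := hstep
      rcases ih with h | h
      · rw [h] at hH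
        exact Or.inr (eq_zero_of_isDescentStepR3_wpBinomial rel mono Φ hne (hNL t t' htt' hne hΦ) hH)
      · rw [h] at hH
        exact Or.inr (eq_zero_of_isDescentStepR3_zero rel mono Φ hH)
  rcases hchain f hpar with h | h
  · exact absurd (h ▸ hroot) (not_isRootPolynomialR3_wpBinomial rel mono Φ htt' hne hΦ)
  · exact h

end Literature.AlgebraicGeometry.Hu2025.Proofs.S04ModelV

end
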